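import Summits.Ventures.LatticeQCDFlow.Scaling.SimulatedTemperingFiniteGap
import Literature.Probability.MarkovChains.MetropolizedGibbs
import Literature.Probability.MarkovChains.PathComparison

/-!
HONEST FRAMING: exact (Metropolis-corrected) sampling algorithms for lattice gauge theory; figures
of merit are autocorrelation/cost numbers at stated couplings and volumes; no continuum-physics
claim.

# SimulatedTemperingFiniteCeiling — THE CEILING IN CLOSED FORM: `Gap ≥ a·min{1,γ_M}/(8(K+1)²)` AND
# `τ_int(g) ≤ 8(K+1)²/(a·min{1,γ_M}) − ½` FOR EVERY OBSERVABLE OF THE HALF-HALF SIMULATED-TEMPERING SAMPLER ON A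
# FINITE CONFIGURATION SPACE; WITH PERFECT WITHIN-LEVEL SAMPLING `τ_int(g) ≤ 8(K+1)²/a − ½` (lean-2 GEN-16, ours)

Venture-side (OURS).  Cell `lqcd-flow` (pub-lqcd), unit `pub-lqcd-lean-2-g16`, 2026-08-24.  Corollaries of
`Scaling/SimulatedTemperingFiniteGap` (`stFin_spectralGap_ge`, `stFin_asympVar_le`) for the half-half scan
`t = ½` (a level move or a within-level update, each with probability `½`), with the constants cleaned up using
`a ≤ 1` (an overlap of probability vectors):

* §1 **`stFinHalf_spectralGap_ge`** — `a·min{1,γ_M}/(8(K+1)²) ≤ Gap(stFinSampler ½ μ M)` (and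
  `stFinHalf_spectralGap_ge_of_gap`, the same from spectral gaps `γ(M_k) ≥ γ_M` via Levin–Peres Remark 13.8);
  **`stFinHalf_asympVar_le`** — `asympVar g π P ≤ (16(K+1)²/(a·min{1,γ_M}) − 1)·Var_π(g)` for EVERY `g`;
  **`stFinHalf_tauInt_le`** — in the integrated-autocorrelation-time currency `τ_int(g) := asympVar/(2Var)`
  (Madras–Slade; the tree's `asympVar`), `τ_int(g) ≤ 8(K+1)²/(a·min{1,γ_M}) − ½` for every non-constant `g`.
* §2 PERFECT WITHIN-LEVEL SAMPLING — `M_k = limitMatrix μ_k` (an independent draw from `μ_k` at every visit, the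
  ideal a trivializing flow at every level would deliver; Poincaré constant `γ_M = 1` EXACTLY,
  `dirichletForm_limitMatrix`): **`stFinPerfect_spectralGap_ge`** — `a/(8(K+1)²) ≤ Gap`;
  **`stFinPerfect_asympVar_le`** — `asympVar g ≤ (16(K+1)²/a − 1)·Var(g)`; **`stFinPerfect_tauInt_le`** —
  `τ_int(g) ≤ 8(K+1)²/a − ½` for every non-constant observable `g` of (level, configuration).

Reading (value-free).  The FLOOR of `Scaling/SimulatedTemperingDiffusive` / `TemperingLevelTauInt` (kernel
level, every exact within-level update, `t = ½`): `τ_int(level) ≥ K(K+2)/(3ā_K) − ½`, `ā_K` the MEAN adjacent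
overlap.  The CEILING here (finite `S`): `τ_int(g) ≤ 8(K+1)²/(a·min{1,γ_M}) − ½`, `a` the LEAST adjacent overlap,
for EVERY observable `g`.  So on a finite configuration space the coupling index of simulated tempering with
exact weights decorrelates in `Θ(K²/a)` sampler steps EXACTLY WHEN the within-level update has a Poincaré
constant bounded below independently of volume and coupling (perfect sampling: `γ_M = 1`); a within-level update
whose Poincaré constant degrades (local updates near a critical coupling, topology freezing at fine spacing)
can inflate the autocorrelation time of EVERY observable by at most the factor `1/γ_M`, and the floor says the
ladder term `K²/ā` never goes away.

NOT CLAIMED: that `1/γ_M` is attained; sharp constants; general configuration spaces; replica exchange; anything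
measured.  Literature grade (cell rule): KNOWN MECHANISM (decomposition bounds for tempering, Madras–Randall 2002,
Woodard–Schmidler–Huber 2009) with explicit constants, NEW TYPING; nothing cited as a fact; no new bib keys.
-/

noncomputable section

open Finset
open Literature.Probability.MarkovChains
open Literature.Probability.MarkovChains.Decomposition

namespace Summit.Ventures.LatticeQCDFlow.Scaling

variable {S : Type*} [Fintype S] [DecidableEq S] {K : ℕ} {μ : Fin (K + 1) → S → ℝ}
  {M : Fin (K + 1) → Matrix S S ℝ}

/-! ## §1 The half-half scan: constants in closed form -/

omit [DecidableEq S] in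
/-- A lower bound on the adjacent overlaps is at most `1` (there is an adjacent pair as soon as `K ≥ 1`). [ours] -/
theorem stFin_overlapFloor_le_one (hK : 1 ≤ K) (hμ1 : ∀ k, ∑ x, μ k x = 1) {a : ℝ}
    (hov : ∀ i j : Fin (K + 1), (j.val = i.val + 1 ∨ i.val = j.val + 1) → a ≤ stFinOverlap μ i j) :
    a ≤ 1 :=
  (hov ⟨0, by omega⟩ ⟨1, by omega⟩ (Or.inl rfl)).trans (stFinOverlap_le_one hμ1 _ _)

/-- Arithmetic of the constants at `t = ½`: `a·min{1,γ}/(8(K+1)²) ≤ min{(½)a/(3(K+1)²), a(1−½)γ/(3(K+1)²+a)}`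
for `0 ≤ a ≤ 1`, `0 ≤ γ`. [ours] -/
theorem stFinHalf_const_le {a γ : ℝ} (ha : 0 ≤ a) (ha1 : a ≤ 1) (hγ : 0 ≤ γ) (K : ℕ) :
    a * min 1 γ / (8 * (K + 1) ^ 2)
      ≤ min (1 / 2 * a / (3 * (K + 1) ^ 2)) (a * (1 - 1 / 2) * γ / (3 * (K + 1) ^ 2 + a)) := by
  have hK : (1 : ℝ) ≤ (K + 1) ^ 2 := by
    have : (1 : ℝ) ≤ K + 1 := by linarith [(Nat.cast_nonneg K : (0 : ℝ) ≤ K)]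
    nlinarith
  have hm1 : min 1 γ ≤ 1 := min_le_left _ _
  have hmγ : min 1 γ ≤ γ := min_le_right _ _
  have hm0 : 0 ≤ min 1 γ := le_min zero_le_one hγ
  refine le_min ?_ ?_
  · rw [div_le_div_iff₀ (by positivity) (by positivity)]
    nlinarith [mul_nonneg ha hm0, mul_le_mul_of_nonneg_left hm1 ha]
  · rw [div_le_div_iff₀ (by positivity) (by positivity)]
    have h1 : a * min 1 γ * (3 * (K + 1) ^ 2 + a) ≤ a * min 1 γ * (4 * (K + 1) ^ 2) :=
      mul_le_mul_of_nonneg_left (by nlinarith) (mul_nonneg ha hm0)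
    have h2 : a * min 1 γ * (4 * (K + 1) ^ 2) ≤ a * γ * (4 * (K + 1) ^ 2) :=
      mul_le_mul_of_nonneg_right (mul_le_mul_of_nonneg_left hmγ ha) (by positivity)
    nlinarith [h1, h2]

/-- **HALF-HALF SCAN, SPECTRAL GAP:** `a·min{1,γ_M}/(8(K+1)²) ≤ Gap(stFinSampler ½ μ M)` — `a ≤` every adjacent
overlap, `γ_M` a uniform Poincaré constant of the (reversible) within-level updates, `K ≥ 1`. [ours] -/
theorem stFinHalf_spectralGap_ge (hK : 1 ≤ K) (hμ : ∀ k x, 0 < μ k x) (hμ1 : ∀ k, ∑ x, μ k x = 1)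
    (hM : ∀ k, IsRowStochastic (M k)) (hMrev : ∀ k, DetailedBalance (μ k) (M k)) {a γ : ℝ} (ha : 0 < a)
    (hγ : 0 < γ)
    (hov : ∀ i j : Fin (K + 1), (j.val = i.val + 1 ∨ i.val = j.val + 1) → a ≤ stFinOverlap μ i j)
    (hgap : ∀ k, ∀ h : S → ℝ, γ * lawVariance (μ k) h ≤ dirichletForm (μ k) (M k) h) :
    a * min 1 γ / (8 * (K + 1) ^ 2) ≤ spectralGap (stFinLaw μ) (stFinSampler (1 / 2) μ M) :=
  (stFinHalf_const_le ha.le (stFin_overlapFloor_le_one hK hμ1 hov) hγ.le K).trans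
    (stFin_spectralGap_ge hK hμ hμ1 hM hMrev (by norm_num) (by norm_num) ha hγ hov hgap)

/-- The same in the SPECTRAL-GAP currency for the within-level updates: if every `M_k` is `μ_k`-reversible with
spectral gap `γ(M_k) ≥ γ_M > 0` (`|S| ≥ 2`), then `a·min{1,γ_M}/(8(K+1)²) ≤ Gap(stFinSampler ½ μ M)`
(Levin–Peres–Wilmer Remark 13.8 turns the gap into the Poincaré constant). [ours] -/
theorem stFinHalf_spectralGap_ge_of_gap [Nontrivial S] (hK : 1 ≤ K) (hμ : ∀ k x, 0 < μ k x)
    (hμ1 : ∀ k, ∑ x, μ k x = 1) (hM : ∀ k, IsRowStochastic (M k)) (hMrev : ∀ k, DetailedBalance (μ k) (M k))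
    {a γ : ℝ} (ha : 0 < a) (hγ : 0 < γ)
    (hov : ∀ i j : Fin (K + 1), (j.val = i.val + 1 ∨ i.val = j.val + 1) → a ≤ stFinOverlap μ i j)
    (hgapM : ∀ k, γ ≤ spectralGap (μ k) (M k)) :
    a * min 1 γ / (8 * (K + 1) ^ 2) ≤ spectralGap (stFinLaw μ) (stFinSampler (1 / 2) μ M) :=
  stFinHalf_spectralGap_ge hK hμ hμ1 hM hMrev ha hγ hov fun k h =>
    (mul_le_mul_of_nonneg_right (hgapM k) (lawVariance_nonneg (fun x => (hμ k x).le) h)).trans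
      (LevinPeres2017_remark_13_8 (hμ k) (hμ1 k) (hM k) (hMrev k) h)

/-- **HALF-HALF SCAN, THE CEILING FOR EVERY OBSERVABLE:** `asympVar g π P ≤ (16(K+1)²/(a·min{1,γ_M}) − 1)·Var_π(g)`
(irreducible within-level updates). [ours] -/
theorem stFinHalf_asympVar_le (hK : 1 ≤ K) (hμ : ∀ k x, 0 < μ k x) (hμ1 : ∀ k, ∑ x, μ k x = 1)
    (hM : ∀ k, IsRowStochastic (M k)) (hMrev : ∀ k, DetailedBalance (μ k) (M k))
    (hMirr : ∀ k, IsIrreducible (M k)) {a γ : ℝ} (ha : 0 < a) (hγ : 0 < γ)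
    (hov : ∀ i j : Fin (K + 1), (j.val = i.val + 1 ∨ i.val = j.val + 1) → a ≤ stFinOverlap μ i j)
    (hgap : ∀ k, ∀ h : S → ℝ, γ * lawVariance (μ k) h ≤ dirichletForm (μ k) (M k) h)
    (g : Fin (K + 1) × S → ℝ) :
    asympVar g (stFinLaw μ) (stFinSampler (1 / 2) μ M)
      ≤ (16 * (K + 1) ^ 2 / (a * min 1 γ) - 1) * lawVariance (stFinLaw μ) g := by
  have h := stFin_asympVar_le (t := 1 / 2) hK hμ hμ1 hM hMrev hMirr (by norm_num) (by norm_num) ha hγ hov hgap g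
  have hc := stFinHalf_const_le ha.le (stFin_overlapFloor_le_one hK hμ1 hov) hγ.le K
  have hc0 : 0 < a * min 1 γ / (8 * (K + 1) ^ 2) := by
    have : 0 < min 1 γ := lt_min one_pos hγ
    positivity
  refine h.trans (mul_le_mul_of_nonneg_right ?_ (lawVariance_nonneg (fun p => (stFinLaw_pos hμ p).le) g))
  have h2 := div_le_div_of_nonneg_left (by norm_num : (0 : ℝ) ≤ 2) hc0 hc
  have h3 : 2 / (a * min 1 γ / (8 * (K + 1) ^ 2)) = 16 * (K + 1) ^ 2 / (a * min 1 γ) := by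
    rw [div_div_eq_mul_div]
    ring
  linarith

/-- **HALF-HALF SCAN, `τ_int` FORM:** for every non-constant observable `g` (`Var_π(g) > 0`),
`τ_int(g) := asympVar/(2·Var) ≤ 8(K+1)²/(a·min{1,γ_M}) − ½`. [ours] -/
theorem stFinHalf_tauInt_le (hK : 1 ≤ K) (hμ : ∀ k x, 0 < μ k x) (hμ1 : ∀ k, ∑ x, μ k x = 1)
    (hM : ∀ k, IsRowStochastic (M k)) (hMrev : ∀ k, DetailedBalance (μ k) (M k))
    (hMirr : ∀ k, IsIrreducible (M k)) {a γ : ℝ} (ha : 0 < a) (hγ : 0 < γ)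
    (hov : ∀ i j : Fin (K + 1), (j.val = i.val + 1 ∨ i.val = j.val + 1) → a ≤ stFinOverlap μ i j)
    (hgap : ∀ k, ∀ h : S → ℝ, γ * lawVariance (μ k) h ≤ dirichletForm (μ k) (M k) h)
    {g : Fin (K + 1) × S → ℝ} (hg : 0 < lawVariance (stFinLaw μ) g) :
    asympVar g (stFinLaw μ) (stFinSampler (1 / 2) μ M) / (2 * lawVariance (stFinLaw μ) g)
      ≤ 8 * (K + 1) ^ 2 / (a * min 1 γ) - 1 / 2 := by
  rw [div_le_iff₀ (by positivity)]
  have h := stFinHalf_asympVar_le hK hμ hμ1 hM hMrev hMirr ha hγ hov hgap g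
  have : (16 * (K + 1) ^ 2 / (a * min 1 γ) - 1) * lawVariance (stFinLaw μ) g
      = (8 * (K + 1) ^ 2 / (a * min 1 γ) - 1 / 2) * (2 * lawVariance (stFinLaw μ) g) := by ring
  linarith

/-! ## §2 Perfect within-level sampling: `M_k = limitMatrix μ_k`, `γ_M = 1` -/

omit [DecidableEq S] in
/-- An independent draw from `μ_k` has Poincaré constant `1` exactly: `𝓔_{μ}(limitMatrix μ; h) = Var_μ(h)`. [ours] -/
theorem perfect_poincare (hμ1 : ∀ k, ∑ x, μ k x = 1) (k : Fin (K + 1)) (h : S → ℝ) :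
    1 * lawVariance (μ k) h ≤ dirichletForm (μ k) (limitMatrix (μ k)) h := by
  rw [one_mul, dirichletForm_limitMatrix (hμ1 k)]

/-- **PERFECT WITHIN-LEVEL SAMPLING, SPECTRAL GAP:** with `M_k = limitMatrix μ_k` the half-half sampler has
`a/(8(K+1)²) ≤ Gap`. [ours] -/
theorem stFinPerfect_spectralGap_ge (hK : 1 ≤ K) (hμ : ∀ k x, 0 < μ k x) (hμ1 : ∀ k, ∑ x, μ k x = 1)
    {a : ℝ} (ha : 0 < a)
    (hov : ∀ i j : Fin (K + 1), (j.val = i.val + 1 ∨ i.val = j.val + 1) → a ≤ stFinOverlap μ i j) :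
    a / (8 * (K + 1) ^ 2)
      ≤ spectralGap (stFinLaw μ) (stFinSampler (1 / 2) μ (fun k => limitMatrix (μ k))) := by
  have h := stFinHalf_spectralGap_ge (M := fun k => limitMatrix (μ k)) hK hμ hμ1
    (fun k => limitMatrix_isRowStochastic (fun x => (hμ k x).le) (hμ1 k))
    (fun k => limitMatrix_detailedBalance (μ k)) ha one_pos hov (perfect_poincare hμ1)
  rwa [min_self, mul_one] at h

/-- **PERFECT WITHIN-LEVEL SAMPLING, THE CEILING:** `asympVar g ≤ (16(K+1)²/a − 1)·Var(g)` for every observable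
`g` of (level, configuration). [ours] -/
theorem stFinPerfect_asympVar_le (hK : 1 ≤ K) (hμ : ∀ k x, 0 < μ k x) (hμ1 : ∀ k, ∑ x, μ k x = 1)
    {a : ℝ} (ha : 0 < a)
    (hov : ∀ i j : Fin (K + 1), (j.val = i.val + 1 ∨ i.val = j.val + 1) → a ≤ stFinOverlap μ i j)
    (g : Fin (K + 1) × S → ℝ) :
    asympVar g (stFinLaw μ) (stFinSampler (1 / 2) μ (fun k => limitMatrix (μ k)))
      ≤ (16 * (K + 1) ^ 2 / a - 1) * lawVariance (stFinLaw μ) g := by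
  have h := stFinHalf_asympVar_le (M := fun k => limitMatrix (μ k)) hK hμ hμ1
    (fun k => limitMatrix_isRowStochastic (fun x => (hμ k x).le) (hμ1 k))
    (fun k => limitMatrix_detailedBalance (μ k)) (fun k => limitMatrix_isIrreducible (hμ k)) ha one_pos hov
    (perfect_poincare hμ1) g
  rwa [min_self, mul_one] at h

/-- **PERFECT WITHIN-LEVEL SAMPLING, `τ_int` FORM:** `τ_int(g) ≤ 8(K+1)²/a − ½` for every non-constant `g` —
against the floor `K(K+2)/(3ā_K) − ½` for the level (`Scaling/TemperingLevelTauInt`, kernel level): the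
tempering bottleneck is `Θ(K²/a)` steps even with the ideal within-level sampler. [ours] -/
theorem stFinPerfect_tauInt_le (hK : 1 ≤ K) (hμ : ∀ k x, 0 < μ k x) (hμ1 : ∀ k, ∑ x, μ k x = 1)
    {a : ℝ} (ha : 0 < a)
    (hov : ∀ i j : Fin (K + 1), (j.val = i.val + 1 ∨ i.val = j.val + 1) → a ≤ stFinOverlap μ i j)
    {g : Fin (K + 1) × S → ℝ} (hg : 0 < lawVariance (stFinLaw μ) g) :
    asympVar g (stFinLaw μ) (stFinSampler (1 / 2) μ (fun k => limitMatrix (μ k)))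
        / (2 * lawVariance (stFinLaw μ) g) ≤ 8 * (K + 1) ^ 2 / a - 1 / 2 := by
  have h := stFinHalf_tauInt_le (M := fun k => limitMatrix (μ k)) hK hμ hμ1
    (fun k => limitMatrix_isRowStochastic (fun x => (hμ k x).le) (hμ1 k))
    (fun k => limitMatrix_detailedBalance (μ k)) (fun k => limitMatrix_isIrreducible (hμ k)) ha one_pos hov
    (perfect_poincare hμ1) hg
  rwa [min_self, mul_one] at h

end Summit.Ventures.LatticeQCDFlow.Scaling

end
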